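import Summits.ResolutionOfSingularities.ResolutionOfSingularities.Theorems.FrobeniusClosingCampaignW41Core4HahnTranscendence
import Mathlib.RingTheory.AlgebraicIndependent.Transcendental
import HarnessLib

/-!
# Crux `Steer` (stmt-16345), chain W4.1 / kill test K4.1b: four algebraically independent generators with `p`-divisible values

OURS (campaign `res-hironaka`, rung L, slot W4.1; replaces the role of no printed item; NOT a statement of
the manuscript under review). Fourth brick of the KERNEL inhabitant of the dim-`≥ 4` Steer core (K4.1b
«ALIVE-BY-KERNEL», seat res-L0-k41). In `Ω = 𝔽_p⟦x^{ℤ[1/p]}⟧`: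

* `transcendental_xPow`: `x ^ p` is transcendental over `𝔽_p` (positive order).
* `transcendental_kserPow`: `κ ^ p` is transcendental over `𝔽_p(x ^ p)` — by VALUES: `𝔽_p[x^p, κ^p]` contains
  `zElt j ^ p` of value `(j+1)p^{R j+1} + p^{-j}` for every `j`, while a degree-`d` algebraic extension of
  `𝔽_p(x^p)` (values `pℤ`) only affords denominators `≤ d` (`exists_nsmul_order_of_isAlgebraic`).
* `exists_independent_generators`: there are power series `θ₂, θ₄` of positive order such that
  `(x^p, θ₂^p, κ^p, θ₄^p)` is ALGEBRAICALLY INDEPENDENT over `𝔽_p` (`θ₂, θ₄` chosen transcendental over the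
  preceding countable subfields by the counting lemma) — the four generators `y₁,…,y₄` of the datum's base
  `A₀ = 𝔽_p[y]`, all of positive value, with `t := x θ₂ + κ^{p+1}` satisfying `t ^ p = y₁ y₂ + y₃ ^ (p+1)`
  (stub-2's `datumPoly`, no `p`-th root extracted in `Ω`).

No `Theses.*` / `Cruxes.*` import (chain build rule). All statements are folklore / direct computation.
-/

-- layout-mandated namespace `Summit.<Summit>.<Problem>.…` with Summit = Problem (single-conjunct summit)
set_option linter.dupNamespace false

namespace Summit.ResolutionOfSingularities.ResolutionOfSingularities.Theorems.SwitchingDichotomy.Core4Hahn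


variable (p : ℕ) [hp : Fact p.Prime]

/-! ## The first and third generators: `x ^ p` and `κ ^ p` -/

/-- `x` has positive order. -/
theorem orderTop_xElt_pos : 0 < (xElt p).orderTop := by
  rw [orderTop_xElt]; exact WithTop.coe_pos.mpr (one'_pos p)

/-- `x ^ p ≠ 0`. -/
theorem xPow_ne_zero : xElt p ^ p ≠ 0 := pow_ne_zero _ (xElt_ne_zero p)

/-- `x ^ p` has positive order. -/
theorem orderTop_xPow_pos : 0 < (xElt p ^ p).orderTop := orderTop_pow_pos (orderTop_xElt_pos p) hp.out.ne_zero

/-- `order (x ^ p) = p • 1`. -/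
theorem order_xPow : (xElt p ^ p).order = p • one' p := by
  have h := orderTop_xElt_pow p p
  rw [← HahnSeries.order_eq_orderTop_of_ne_zero (xPow_ne_zero p)] at h
  exact WithTop.coe_injective h

/-- `κ ^ p ≠ 0` and has positive order. -/
theorem kserPow_ne_zero : kser p ^ p ≠ 0 := pow_ne_zero _ (kser_ne_zero p)

/-- `κ ^ p` has positive order. -/
theorem orderTop_kserPow_pos : 0 < (kser p ^ p).orderTop :=
  orderTop_pow_pos (by rw [orderTop_kser]; exact WithTop.coe_pos.mpr (expo_pos p 1)) hp.out.ne_zero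

/-- **`x ^ p` is transcendental over `𝔽_p`.** -/
theorem transcendental_xPow : Transcendental (ZMod p) (xElt p ^ p) :=
  transcendental_of_orderTop_pos (xPow_ne_zero p) (orderTop_xPow_pos p)

/-- `zElt j ^ p ∈ 𝔽_p[x ^ p, κ ^ p]`. -/
theorem zEltPow_mem_adjoin (j : ℕ) :
    zElt p j ^ p ∈ Algebra.adjoin (ZMod p) ({xElt p ^ p, kser p ^ p} : Set (Ω p)) := by
  haveI := charP_Ω p
  have h := pow_mem_adjoin_image_pow (k := ZMod p) p ({xElt p, kser p} : Set (Ω p)) (zElt_mem_adjoin p j)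
  rwa [Set.image_pair] at h

/-- The rational value of `order (zElt j ^ p)`: `(j+1) p^{R j + 1} + p^{-j}`. -/
theorem coe_order_zEltPow (j : ℕ) :
    (((zElt p j ^ p).order : PInv p) : ℚ) = (j + 1) * (p : ℚ) ^ (R j + 1) + ((p : ℚ) ^ j)⁻¹ := by
  have h1 : (zElt p j ^ p).order = p • (zElt p j).order := HahnSeries.order_pow _ _
  have h2 : (zElt p j).order = p ^ R j • expo p (j + 1) := by
    have h := orderTop_zElt p j
    rw [← HahnSeries.order_eq_orderTop_of_ne_zero (zElt_ne_zero p j)] at h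
    exact WithTop.coe_injective h
  rw [h1, h2, AddSubgroupClass.coe_nsmul, coe_nsmul_expo]
  have hp0 : (p : ℚ) ≠ 0 := (Nat.cast_ne_zero.mpr hp.out.ne_zero)
  simp only [nsmul_eq_mul]
  rw [pow_succ, pow_succ]
  field_simp

/-- **`κ ^ p` is transcendental over `𝔽_p(x ^ p)`** (value argument; no lacunarity estimate). -/
theorem transcendental_kserPow :
    Transcendental (IntermediateField.adjoin (ZMod p) ({xElt p ^ p} : Set (Ω p))) (kser p ^ p) := by
  intro halg
  obtain ⟨d, hd, H⟩ :=
    exists_nsmul_order_of_isAlgebraic (IntermediateField.adjoin (ZMod p) ({xElt p ^ p} : Set (Ω p))) halg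
  -- the witness `z = zElt d ^ p ∈ 𝔽_p(x^p)(κ^p) = 𝔽_p(x^p, κ^p)`
  have hzmem : zElt p d ^ p ∈ IntermediateField.adjoin
      (IntermediateField.adjoin (ZMod p) ({xElt p ^ p} : Set (Ω p))) ({kser p ^ p} : Set (Ω p)) := by
    have h' : zElt p d ^ p ∈ (IntermediateField.adjoin
        (IntermediateField.adjoin (ZMod p) ({xElt p ^ p} : Set (Ω p))) ({kser p ^ p} : Set (Ω p))).restrictScalars
        (ZMod p) := by
      rw [IntermediateField.adjoin_adjoin_left, ← Set.insert_eq]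
      exact IntermediateField.algebra_adjoin_le_adjoin _ _ (zEltPow_mem_adjoin p d)
    exact (IntermediateField.mem_restrictScalars _).mp h'
  set z := zElt p d ^ p with hz
  have hz0 : z ≠ 0 := pow_ne_zero _ (zElt_ne_zero p d)
  obtain ⟨n, hn0, hnd, b, c, hb, hc, hb0, hc0, hrel⟩ := H z hzmem hz0
  obtain ⟨mb, hmb⟩ := order_eq_zsmul_of_mem_adjoin_simple (xPow_ne_zero p) (orderTop_xPow_pos p) hb hb0
  obtain ⟨mc, hmc⟩ := order_eq_zsmul_of_mem_adjoin_simple (xPow_ne_zero p) (orderTop_xPow_pos p) hc hc0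
  -- read the relation in ℚ
  have hxq : (((xElt p ^ p).order : PInv p) : ℚ) = p := by
    rw [order_xPow, AddSubmonoidClass.coe_nsmul, coe_one', nsmul_eq_mul, mul_one]
  have hbq : ((b.order : PInv p) : ℚ) = mb * p := by
    rw [hmb, AddSubgroupClass.coe_zsmul, hxq, zsmul_eq_mul]
  have hcq : ((c.order : PInv p) : ℚ) = mc * p := by
    rw [hmc, AddSubgroupClass.coe_zsmul, hxq, zsmul_eq_mul]
  have hq : (n : ℚ) * ((d + 1) * (p : ℚ) ^ (R d + 1) + ((p : ℚ) ^ d)⁻¹) + mc * p = mb * p := by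
    have h := congrArg (fun g : PInv p => (g : ℚ)) hrel
    simp only [AddMemClass.coe_add, AddSubmonoidClass.coe_nsmul, nsmul_eq_mul, hbq, hcq, hz,
      coe_order_zEltPow] at h
    exact_mod_cast h
  have hp0 : (p : ℚ) ≠ 0 := (Nat.cast_ne_zero.mpr hp.out.ne_zero)
  have hpd : (p : ℚ) ^ d ≠ 0 := pow_ne_zero _ hp0
  -- `n = p^d * N` with an integer `N`
  have h1 : (n : ℚ) * ((p : ℚ) ^ d)⁻¹ = p * (mb - mc) - n * (d + 1) * (p : ℚ) ^ (R d + 1) := by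
    linear_combination hq
  have key : (n : ℚ) = (p : ℚ) ^ d * (p * (mb - mc) - n * (d + 1) * (p : ℚ) ^ (R d + 1)) := by
    rw [← h1]; field_simp
  have keyZ : (n : ℤ) = (p : ℤ) ^ d * (p * (mb - mc) - n * (d + 1) * (p : ℤ) ^ (R d + 1)) := by
    exact_mod_cast key
  set N : ℤ := p * (mb - mc) - n * (d + 1) * (p : ℤ) ^ (R d + 1) with hN
  have hpdpos : (0 : ℤ) < (p : ℤ) ^ d := pow_pos (by exact_mod_cast hp.out.pos) _
  have hNpos : 0 < N := by
    by_contra hle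
    have hle' : N ≤ 0 := not_lt.mp hle
    have : (n : ℤ) ≤ 0 := by rw [keyZ]; exact mul_nonpos_of_nonneg_of_nonpos hpdpos.le hle'
    omega
  have hge : (p : ℤ) ^ d ≤ n := by
    rw [keyZ]
    exact le_mul_of_one_le_right hpdpos.le hNpos
  have hlt : d < p ^ d := Nat.lt_pow_self hp.out.one_lt
  have : (n : ℤ) ≤ d := by exact_mod_cast hnd
  have : ((p ^ d : ℕ) : ℤ) ≤ d := by push_cast; omega
  omega

/-! ## Four algebraically independent generators -/

/-- A transcendental element is non-zero. -/
theorem ne_zero_of_transcendental {B : Subalgebra (ZMod p) (Ω p)} {θ : Ω p} (h : Transcendental B θ) : θ ≠ 0 :=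
  fun h0 => h (h0 ▸ isAlgebraic_zero)

/-- The carrier of an intermediate field generated by finitely many elements, seen through `toSubalgebra`,
is countable. -/
theorem countable_toSubalgebra_adjoin {ι : Type} [Finite ι] (v : ι → Ω p) :
    (((IntermediateField.adjoin (ZMod p) (Set.range v)).toSubalgebra : Subalgebra (ZMod p) (Ω p)) :
      Set (Ω p)).Countable :=
  countable_adjoin_of_finite p _ (Set.finite_range v)

/-- **The four generators.** There are `θ₂, θ₄ ∈ Ω` of positive order such that
`(x ^ p, θ₂ ^ p, κ ^ p, θ₄ ^ p)` is algebraically independent over `𝔽_p`. -/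
theorem exists_independent_generators :
    ∃ θ₂ θ₄ : Ω p, 0 < θ₂.orderTop ∧ θ₂ ≠ 0 ∧ 0 < θ₄.orderTop ∧ θ₄ ≠ 0 ∧
      AlgebraicIndependent (ZMod p) ![xElt p ^ p, θ₂ ^ p, kser p ^ p, θ₄ ^ p] := by
  -- stage 1: `x^p`
  set v₁ : Fin 1 → Ω p := ![xElt p ^ p] with hv₁
  have h1 : AlgebraicIndependent (ZMod p) v₁ :=
    (algebraicIndependent_iff_transcendental).mpr (transcendental_xPow p)
  -- stage 2: `κ^p` over `𝔽_p(x^p)`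
  have hrange₁ : Set.range v₁ = {xElt p ^ p} := by
    rw [hv₁]; ext w; simp
  have hle₁ : Algebra.adjoin (ZMod p) (Set.range v₁) ≤
      (IntermediateField.adjoin (ZMod p) ({xElt p ^ p} : Set (Ω p))).toSubalgebra := by
    rw [hrange₁]; exact IntermediateField.algebra_adjoin_le_adjoin _ _
  set v₂ : Option (Fin 1) → Ω p := fun o => o.elim (kser p ^ p) v₁ with hv₂
  have h2 : AlgebraicIndependent (ZMod p) v₂ :=
    (AlgebraicIndependent.option_iff).mpr
      ⟨h1, Transcendental.of_tower_top_of_subalgebra_le hle₁ (transcendental_kserPow p)⟩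
  -- stage 3: generic `θ₂`
  set E₂ := IntermediateField.adjoin (ZMod p) (Set.range v₂) with hE₂
  obtain ⟨c₂, hc₂⟩ := exists_natSer_transcendental p E₂.toSubalgebra (countable_toSubalgebra_adjoin p v₂)
  set θ₂ := natSer p c₂ with hθ₂
  have hT₂ : Transcendental (Algebra.adjoin (ZMod p) (Set.range v₂)) (θ₂ ^ p) :=
    Transcendental.of_tower_top_of_subalgebra_le (IntermediateField.algebra_adjoin_le_adjoin _ _)
      (hc₂.pow hp.out.pos)
  set v₃ : Option (Option (Fin 1)) → Ω p := fun o => o.elim (θ₂ ^ p) v₂ with hv₃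
  have h3 : AlgebraicIndependent (ZMod p) v₃ := (AlgebraicIndependent.option_iff).mpr ⟨h2, hT₂⟩
  -- stage 4: generic `θ₄`
  set E₃ := IntermediateField.adjoin (ZMod p) (Set.range v₃) with hE₃
  obtain ⟨c₄, hc₄⟩ := exists_natSer_transcendental p E₃.toSubalgebra (countable_toSubalgebra_adjoin p v₃)
  set θ₄ := natSer p c₄ with hθ₄
  have hT₄ : Transcendental (Algebra.adjoin (ZMod p) (Set.range v₃)) (θ₄ ^ p) :=
    Transcendental.of_tower_top_of_subalgebra_le (IntermediateField.algebra_adjoin_le_adjoin _ _)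
      (hc₄.pow hp.out.pos)
  set v₄ : Option (Option (Option (Fin 1))) → Ω p := fun o => o.elim (θ₄ ^ p) v₃ with hv₄
  have h4 : AlgebraicIndependent (ZMod p) v₄ := (AlgebraicIndependent.option_iff).mpr ⟨h3, hT₄⟩
  -- reindex by `Fin 4`
  let e : Fin 4 → Option (Option (Option (Fin 1))) :=
    ![some (some (some 0)), some none, some (some none), none]
  have he : Function.Injective e := by decide
  have hcomp : ![xElt p ^ p, θ₂ ^ p, kser p ^ p, θ₄ ^ p] = v₄ ∘ e := by
    funext i
    fin_cases i <;> rfl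
  refine ⟨θ₂, θ₄, orderTop_natSer_pos p c₂, ne_zero_of_transcendental p hc₂, orderTop_natSer_pos p c₄,
    ne_zero_of_transcendental p hc₄, ?_⟩
  rw [hcomp]
  exact h4.comp e he

end Summit.ResolutionOfSingularities.ResolutionOfSingularities.Theorems.SwitchingDichotomy.Core4Hahn
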